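import Mathlib.Analysis.SpecialFunctions.Log.Base
import Literature.InformationTheory.Entropy.MapEntropy
import HarnessLib

/-!
# Subadditivity of the entropy of images of uniform distributions: `H((f, g)) ≤ H(f) + H(g)`

Topic `Literature/InformationTheory/Entropy` (the `mapEntropy` API of `MapEntropy.lean`: Shannon
entropy, in bits, of the image `f(U_S)` of the uniform distribution on a finite set `S`).  For two
maps `f : S → β`, `g : S → β'` the joint image `(f, g)(U_S)` has entropy at most the sum of the
entropies of the marginals,

  `H((f v, g v))_{v ∼ U_S} ≤ H(f(U_S)) + H(g(U_S))`        (`mapEntropy_prod_le`),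

i.e. the mutual information `I(f(U_S); g(U_S))` is nonnegative (Cover–Thomas, Thm. 2.6.5 and its
corollary (2.96), `H(X, Y) ≤ H(X) + H(Y)`).  Proof (standard): in the expected-surprise form the
difference `H(f,g) − H(f) − H(g)` is the average over `v ∈ S` of `log₂ t_v`,
`t_v = |f⁻¹(f v)|·|g⁻¹(g v)| / (|S|·|(f,g)⁻¹(f v, g v)|)`; by `log t ≤ t − 1` it suffices that
`∑_v t_v ≤ |S|`, and regrouping the sum by the fibres of `(f, g)` gives
`∑_v t_v = (1/|S|) ∑_{(x,y) ∈ (f,g)(S)} |f⁻¹(x)|·|g⁻¹(y)| ≤ (1/|S|) ∑_{x ∈ f(S)} ∑_{y ∈ g(S)} |f⁻¹(x)|·|g⁻¹(y)| = |S|`.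
Also recorded: the regrouping identity `sum_div_card_fiber_eq_sum_image` and the corollary
`mapEntropy_le_fst_add_snd` (a pair-valued map against its two components), the form used for
entropy-DEFECT certificates `H(P) ≤ H(P₁) + h(biased bit)` (first user: `Summits/PneNP`, route
`SzkEntropy`, crux `PeaWorstToAvg`, crux-ideate sketch `SketchIdeator2.lean`).

Mathlib has measure-theoretic entropy/`klDiv` but not this finite counting form; the tree's
`MapEntropy.lean` has the chain rule with a revealed coordinate (`MapEntropyChainRule.lean`) and
`H(g ∘ f) ≤ H(f)` (`mapEntropy_comp_le`) but not subadditivity.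

## References

* T. M. Cover, J. A. Thomas, *Elements of Information Theory*, 2nd ed., Wiley 2006, Thm. 2.6.5
  (`I(X;Y) ≥ 0`) and (2.96) (`H(X,Y) ≤ H(X) + H(Y)`); Thm. 2.6.3 (information inequality, via
  `log t ≤ t − 1`). [folklore]
-/

namespace Literature.InformationTheory.Entropy

open Finset

variable {ι β β' : Type*} [DecidableEq β] [DecidableEq β']

/-- **Regrouping an average by fibres.** A summand of the form `a(F v) / |F⁻¹(F v) ∩ S|` sums over
`S` to `∑_{z ∈ F(S)} a z` (each fibre contributes `|fibre| · a z / |fibre|`). [folklore] -/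
theorem sum_div_card_fiber_eq_sum_image (S : Finset ι) (F : ι → β) (a : β → ℝ) :
    ∑ v ∈ S, a (F v) / (fiber S F (F v)).card = ∑ z ∈ S.image F, a z := by
  rw [← sum_fiberwise_of_maps_to (s := S) (t := S.image F) (g := F)
    (fun v hv => mem_image_of_mem F hv)]
  refine sum_congr rfl fun z hz => ?_
  have hcard : (0 : ℝ) < (fiber S F z).card := by
    obtain ⟨v, hv, rfl⟩ := mem_image.1 hz
    exact_mod_cast card_fiber_pos F hv
  calc ∑ v ∈ S.filter (fun v => F v = z), a (F v) / (fiber S F (F v)).card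
      = ∑ v ∈ S.filter (fun v => F v = z), a z / (fiber S F z).card :=
        sum_congr rfl fun v hv => by rw [(mem_filter.1 hv).2]
    _ = (fiber S F z).card • (a z / (fiber S F z).card) := by
        rw [sum_const]
        rfl
    _ = a z := by
        rw [nsmul_eq_mul]
        field_simp

/-- The fibre sizes of `f` over its image add up to `|S|` (real-valued form of
`Finset.card_eq_sum_card_image`). [folklore] -/
theorem sum_card_fiber_image (S : Finset ι) (f : ι → β) :
    ∑ x ∈ S.image f, ((fiber S f x).card : ℝ) = S.card := by
  rw [card_eq_sum_card_image f S, Nat.cast_sum]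
  rfl

/-- The elementary inequality behind subadditivity: for positive reals,
`log₂(N/c) ≤ log₂(N/a) + log₂(N/b) + (ab/(Nc) − 1)/ln 2` (the exact identity
`log₂(N/c) − log₂(N/a) − log₂(N/b) = log₂ (ab/(Nc))` followed by `log t ≤ t − 1`). [folklore] -/
theorem logb_div_le_add_add_sub_one {N a b c : ℝ} (hN : 0 < N) (ha : 0 < a) (hb : 0 < b)
    (hc : 0 < c) :
    Real.logb 2 (N / c) ≤
      Real.logb 2 (N / a) + Real.logb 2 (N / b) + (a * b / (N * c) - 1) / Real.log 2 := by
  have hlog2 : 0 < Real.log 2 := Real.log_pos one_lt_two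
  have ht : 0 < a * b / (N * c) := by positivity
  have h1 : Real.log (a * b / (N * c)) ≤ a * b / (N * c) - 1 := Real.log_le_sub_one_of_pos ht
  have hid : Real.logb 2 (N / c) - Real.logb 2 (N / a) - Real.logb 2 (N / b) =
      Real.log (a * b / (N * c)) / Real.log 2 := by
    simp only [Real.logb]
    rw [Real.log_div hN.ne' hc.ne', Real.log_div hN.ne' ha.ne', Real.log_div hN.ne' hb.ne',
      Real.log_div (by positivity) (by positivity), Real.log_mul ha.ne' hb.ne',
      Real.log_mul hN.ne' hc.ne']
    field_simp
    ring
  have h2 : Real.log (a * b / (N * c)) / Real.log 2 ≤ (a * b / (N * c) - 1) / Real.log 2 :=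
    (div_le_div_iff_of_pos_right hlog2).2 h1
  linarith

/-- **Subadditivity of entropy** for images of a uniform distribution: the joint image
`(f, g)(U_S)` has entropy at most `H(f(U_S)) + H(g(U_S))` (equivalently, the mutual information of
`f(U_S)` and `g(U_S)` is nonnegative). [Cover–Thomas 2006, Thm. 2.6.5 and (2.96)] [folklore] -/
theorem mapEntropy_prod_le (S : Finset ι) (f : ι → β) (g : ι → β') :
    mapEntropy S (fun v => (f v, g v)) ≤ mapEntropy S f + mapEntropy S g := by
  rcases S.eq_empty_or_nonempty with rfl | hS
  · simp
  set F : ι → β × β' := fun v => (f v, g v) with hF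
  have hN : (0 : ℝ) < S.card := by exact_mod_cast hS.card_pos
  -- fibre sizes (all positive on `S`)
  have ha : ∀ v ∈ S, (0 : ℝ) < (fiber S f (f v)).card := fun v hv => by
    exact_mod_cast card_fiber_pos f hv
  have hb : ∀ v ∈ S, (0 : ℝ) < (fiber S g (g v)).card := fun v hv => by
    exact_mod_cast card_fiber_pos g hv
  have hc : ∀ v ∈ S, (0 : ℝ) < (fiber S F (F v)).card := fun v hv => by
    exact_mod_cast card_fiber_pos F hv
  -- the counting step: `∑_v |f⁻¹(f v)|·|g⁻¹(g v)| / |F⁻¹(F v)| ≤ |S|²`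
  have hcount : ∑ v ∈ S, ((fiber S f (f v)).card : ℝ) * (fiber S g (g v)).card /
      (fiber S F (F v)).card ≤ (S.card : ℝ) * S.card := by
    have hre : ∀ v ∈ S, ((fiber S f (f v)).card : ℝ) * (fiber S g (g v)).card /
        (fiber S F (F v)).card =
        (fun z : β × β' => ((fiber S f z.1).card : ℝ) * (fiber S g z.2).card) (F v) /
          (fiber S F (F v)).card := fun v _ => rfl
    rw [sum_congr rfl hre, sum_div_card_fiber_eq_sum_image S F
      (fun z : β × β' => ((fiber S f z.1).card : ℝ) * (fiber S g z.2).card)]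
    calc ∑ z ∈ S.image F, ((fiber S f z.1).card : ℝ) * (fiber S g z.2).card
        ≤ ∑ z ∈ S.image f ×ˢ S.image g, ((fiber S f z.1).card : ℝ) * (fiber S g z.2).card := by
          apply sum_le_sum_of_subset_of_nonneg
          · intro z hz
            obtain ⟨v, hv, rfl⟩ := mem_image.1 hz
            exact mem_product.2 ⟨mem_image_of_mem f hv, mem_image_of_mem g hv⟩
          · intro z _ _
            positivity
      _ = (∑ x ∈ S.image f, ((fiber S f x).card : ℝ)) * ∑ y ∈ S.image g, ((fiber S g y).card : ℝ) := by
          rw [sum_product, sum_mul_sum]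
      _ = (S.card : ℝ) * S.card := by rw [sum_card_fiber_image, sum_card_fiber_image]
  -- hence `∑_v (t_v - 1) ≤ 0`
  have ht : ∑ v ∈ S, (((fiber S f (f v)).card : ℝ) * (fiber S g (g v)).card /
      (S.card * (fiber S F (F v)).card) - 1) ≤ 0 := by
    rw [sum_sub_distrib, sum_const, nsmul_eq_mul, mul_one, sub_nonpos]
    have hre : ∀ v ∈ S, ((fiber S f (f v)).card : ℝ) * (fiber S g (g v)).card /
        (S.card * (fiber S F (F v)).card) =
        (S.card : ℝ)⁻¹ * (((fiber S f (f v)).card : ℝ) * (fiber S g (g v)).card /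
          (fiber S F (F v)).card) := fun v hv => by
      field_simp
    rw [sum_congr rfl hre, ← mul_sum]
    calc (S.card : ℝ)⁻¹ * ∑ v ∈ S, ((fiber S f (f v)).card : ℝ) * (fiber S g (g v)).card /
          (fiber S F (F v)).card ≤ (S.card : ℝ)⁻¹ * ((S.card : ℝ) * S.card) :=
          mul_le_mul_of_nonneg_left hcount (inv_nonneg.2 hN.le)
      _ = S.card := by field_simp
  -- sum the elementary inequality over `S`
  have hsum : ∑ v ∈ S, Real.logb 2 ((S.card : ℝ) / (fiber S F (F v)).card) ≤
      ∑ v ∈ S, (Real.logb 2 ((S.card : ℝ) / (fiber S f (f v)).card) +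
        Real.logb 2 ((S.card : ℝ) / (fiber S g (g v)).card) +
        (((fiber S f (f v)).card : ℝ) * (fiber S g (g v)).card /
          (S.card * (fiber S F (F v)).card) - 1) / Real.log 2) :=
    sum_le_sum fun v hv => logb_div_le_add_add_sub_one hN (ha v hv) (hb v hv) (hc v hv)
  rw [sum_add_distrib, sum_add_distrib, ← sum_div] at hsum
  have hlog2 : 0 < Real.log 2 := Real.log_pos one_lt_two
  have hlast : (∑ v ∈ S, (((fiber S f (f v)).card : ℝ) * (fiber S g (g v)).card /
      (S.card * (fiber S F (F v)).card) - 1)) / Real.log 2 ≤ 0 :=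
    div_nonpos_of_nonpos_of_nonneg ht hlog2.le
  -- assemble
  unfold mapEntropy
  rw [← add_div, div_le_div_iff_of_pos_right hN]
  linarith

/-- **Entropy of a pair-valued map against its components**: `H(P) ≤ H(P₁) + H(P₂)` for
`P : S → G × H` (`mapEntropy_prod_le` with `f = Prod.fst ∘ P`, `g = Prod.snd ∘ P`).  With `H` a
biased bit split off a sampler this is the entropy-defect certificate `H(P) ≤ H(P₁) + h(bias)`.
[Cover–Thomas 2006, (2.96)] [folklore] -/
theorem mapEntropy_le_fst_add_snd {G H : Type*} [DecidableEq G] [DecidableEq H] (S : Finset ι)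
    (P : ι → G × H) :
    mapEntropy S P ≤ mapEntropy S (fun v => (P v).1) + mapEntropy S (fun v => (P v).2) := by
  simpa only [Prod.mk.eta] using mapEntropy_prod_le S (fun v => (P v).1) (fun v => (P v).2)

end Literature.InformationTheory.Entropy
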